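import Summits.HodgeConjecture.CorCM.MultiFieldWeilSlotwiseSeparation
import Summits.HodgeConjecture.CorCM.MultiFieldWeilQuarticSlotMovers
import Summits.HodgeConjecture.CorCM.MultiFieldWeilSexticsDecicsIntrinsic
import HarnessLib

/-!
# MULTI-FIELD WEIL ENGINE — OCTIC SLOTS: any number of simple CM threefolds (sextic fields), of `(1,3)`- and `(2,2)`-FOURFOLDS over OCTIC CM fields with
# `2`-transitive quartic part, and of `(2,3)`-fivefolds (decic fields), all through one imaginary quadratic `k` — the Hodge conjecture for every product of copies,
# given only Markman's fourfold and hyperbolic-sixfold theorems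

Cell `pub-hodgecm2` (COR-CM), seat b30 gen 38 (2026-08-25); count-neutral own lane MULTI-FIELD WEIL ENGINE (stem `MultiFieldWeil*`), the geometric consumer of
`CorCM/MultiFieldWeilSlotwiseSeparation.lean` (Z1: the defect law slot by slot, no primality), `CorCM/MultiFieldWeilQuarticSlotMovers.lean` (Z2: stabiliser-transitivity
into `2`-transitive quartic slots) and `CorCM/MultiFieldWeilSexticsDecicsIntrinsic.lean` (Y3), built on the engine `hodgeConjectureFor_biproduct_comp_of_defectLawG`
(`CorCM/MultiFieldWeilHodge.lean`) and the Markman dispatcher `weilHyp_of_markman_intrinsic`.  Theorems only; no definition, no named fact, no `sorry`.  HONEST FRAMING: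
conditional ONLY on the two displayed binders `Markman2025_weilClasses_algebraic_abelianFourfold` (sextic `(1,2)` and octic `(2,2)` slots) and
`Markman2025_weilClasses_algebraic_hyperbolicSixfold` (octic `(1,3)` and decic `(2,3)` slots); `HC_CM` is NOT proved and not asserted.

§1 **THE FRAMES HEADLINE WITHOUT PRIMALITY** (`hodgeConjectureFor_biproduct_comp_of_kind_frames`): V2's `hodgeConjectureFor_biproduct_comp_of_stabiliserTransitive_frames`
with «`n_m` prime» replaced by the slot menu of Z1 — prime size, OR one-member position set, OR homogeneous realised image.

§2 **THE INTRINSIC HEADLINE UNDER `hST`** (`hodgeConjectureFor_biproduct_comp_of_octics_of_stabiliserTransitive`): slots `(n_m, p_m) ∈ {(3,1), (4,1), (4,2), (5,2)}`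
(simple CM threefolds over sextic fields; CM fourfolds of `k`-signature `(1,3)` or `(2,2)` over octic fields; Weil-type fivefolds over decic fields); `hST`
(for `m₀ ≠ m` and `τ`-embeddings `s, s'` of `K_m` an automorphism of `ℂ` over `τ(k)` fixing all `τ`-embeddings of `K_{m₀}` carries `s` to `s'`); and for the `(4,2)`
slots `h2T` (`Aut(ℂ/τk)` `2`-transitive on the four `τ`-embeddings: quartic part `𝔄₄` or `𝔖₄`) ⟹ HC for every product of copies, mod Markman 4 + 6.

§3 **`hST` DISCHARGED FOR THE MIXED MENU** (`stabTransitive_realisedTuples_of_menu`, realised level): sizes `n_m ∈ {3, 4, 5}`, realised tuples `2`-transitive on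
every slot of size `4`, and ONE `τ`-embedding with ONE value outside the Galois closure asked ONLY for the pairs `(m₀, m)` with `n_{m₀} = n_m` or `(n_{m₀}, n_m) = (4, 3)`:
the nine cases are W1 (`3→3`, `5→5`, `4→3`: prime blocks), Y2 (`3↔5`: free), Z2 (`3→4`, `5→4`, `4→5`: free; `4→4`: mover + primitivity).

§4 **HEADLINE `hodgeConjectureFor_biproduct_comp_of_sexticsOcticsDecics`.**  `k = Kf i₀` imaginary quadratic, `E = A 0 ⊨ (k; {τ})`, `B_m = A (m+1) ⊨ (K_m; Φ (m+1))`,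
`([K_m : k], #(Φ (m+1) over τ)) ∈ {(3,1), (4,1), (4,2), (5,2)}`, such that: (i) for every OCTIC `K_m` the automorphisms of `ℂ` over `τ(k)` are `2`-transitive on its
`τ`-embeddings; (ii) for `m₀ ≠ m` of EQUAL degree, and for `K_{m₀}` octic with `K_m` sextic, some `τ`-embedding of `K_m` takes some value outside `L(K_{m₀})`.  Then the
Hodge conjecture holds for EVERY product of copies `⨁_j A(κ j)` and everything it dominates, GIVEN ONLY Markman's two theorems.  `…_of_isEmpty_ringHom`: (ii) for
sextic–sextic and decic–decic pairs from `Hom(K_m, K_{m₀}) = ∅` (W1 §3, Y1 §1).  NOT covered, honestly: octic fields whose quartic part is `C₄`, `V₄` or `D₄` (there the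
cross-slot statements are false in general — the biquadratic example of Z2; single such slots are gens 18–21's `OcticCurveFourfold*` ∕ `OcticWeil*` files); several
non-isogenous factors over ISOMORPHIC fields.

[cite: Markman2025SurveySecant, Thm. 1.2] [cite: Markman2025SecantWeil, Thm 1.5.1] [cite: Pohlmann1968, Thm 1] [cite: MoonenZarhin1995Duke, Thm. 2.4]
[cite: Milne2020HodgeClassesAV, 1.2 (a) and Thm. 1] [cite: DixonMortimer1996, §1.6, Thm. 1.6A; §3.3, Thm. 3.3A] [cite: Wielandt1964, §9–§10, §13] [cite: Lang2002, I §5 Thm. 5.5, VI §1 Thm. 1.1]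
[cite: Dodson1984, §1.1 Imprimitivity Theorem and §5.1.2 Theorem] [cite: Shimura1998, §18.2 Lemma (i)] [cite: MumfordAV1970, §19]

## References
* [Markman2025SurveySecant] E. Markman, arXiv:2509.23403, Thm. 1.2.  [Markman2025SecantWeil] E. Markman, Cycles on abelian 2n-folds of Weil type from secant sheaves on abelian
  n-folds, Thm 1.5.1.  [Pohlmann1968] H. Pohlmann, Ann. of Math. 88 (1968), Thm 1.  [MoonenZarhin1995Duke] B. Moonen, Yu. Zarhin, Duke Math. J. 77 (1995), Thm. 2.4.
  [Milne2020HodgeClassesAV] J. S. Milne, Hodge classes on abelian varieties (2020), 1.2 (a), Thm. 1.  [DixonMortimer1996] J. D. Dixon, B. Mortimer, *Permutation Groups*,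
  GTM 163, §1.6, §3.3.  [Wielandt1964] H. Wielandt, *Finite permutation groups*, §9–§10, §13.  [Lang2002] S. Lang, *Algebra*, GTM 211, I §5, VI §1.  [Dodson1984] B. Dodson,
  Trans. AMS 283 (1984), §1.1, §5.1.2.  [Shimura1998] G. Shimura, *Abelian varieties with complex multiplication and modular functions*, §18.2.  [MumfordAV1970]
  D. Mumford, *Abelian Varieties*, §19.
-/

noncomputable section

open CategoryTheory CategoryTheory.Limits NumberField IntermediateField

namespace Summit.HodgeConjecture.CorCM.MultiFieldWeil

open Finset
open Literature.AlgebraicGeometry Literature.AlgebraicGeometry.Motives Literature.AlgebraicGeometry.HodgeTheory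
open Literature.AlgebraicGeometry.ComplexMultiplication (IsCMTypeRealisation)
open Literature.AlgebraicTopology.SingularHomology
open Literature.NumberTheory.ComplexMultiplication
open Summit.HodgeConjecture.CorCM.Census.MultiFieldWeil

open scoped Classical

/-! ## §1 The frames headline without primality -/

section Frames

variable {I : Type} {r : ℕ} {Kf : I → Type} [∀ i, Field (Kf i)] [∀ i, NumberField (Kf i)] [∀ i, IsCMField (Kf i)]
  {i₀ : I} {is : Fin r → I} {n : Fin r → ℕ} {τ : Kf i₀ →+* ℂ}
  {A : Fin (r + 1) → AbelianVariety ℂ} {Φ : ∀ j : Fin (r + 1), CMType (Kf (mfSlots i₀ is j))}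
  {ι : ∀ j, 𝓞 (Kf (mfSlots i₀ is j)) →+* End (A j)}
  {θ : ∀ j, Kf (mfSlots i₀ is j) →+* Module.End ℂ (complexBetti (A j).X 1)}

/-- **HEADLINE (frame form) — THE SLOT MENU: PRIME SIZE, OR ONE-MEMBER TYPE, OR HOMOGENEOUS REALISED IMAGE; STABILISER-TRANSITIVE REALISED TUPLES; NO TOWER, NO
PRIMALITY.**  `k = Kf i₀` imaginary quadratic, `E = A 0 ⊨ (k; {τ})` (`τ(δ) = i√d`), `B_m = A (m+1) ⊨ (K_m; Φ (m+1))` over CM fields `K_m ⊇ i_m(k)`, `[K_m : k] = n_m`, types read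
by frames `e m` at position sets `P m` of sizes `p_m` (`0 < p_m`, `2 p_m ≤ n_m`); each slot of PRIME size, or with `p_m = 1`, or with every `p_m`-subset
of its positions a translate `(π_m)⁻¹ P_m` by a realised tuple; the realised tuples trivial at each slot transitive on every other slot.  Then the Hodge conjecture holds
for EVERY product of copies `⨁_j A(κ j)` GIVEN the single-slot Weil spaces `hW m`.  `HC_CM` is NOT asserted. [cite: Pohlmann1968, Thm 1] [cite: MoonenZarhin1995Duke, Thm. 2.4]
[cite: Milne2020HodgeClassesAV, 1.2 (a) and Thm. 1] [cite: DixonMortimer1996, §1.6, Thm. 1.6A; §2.1] -/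
theorem hodgeConjectureFor_biproduct_comp_of_kind_frames (P : ∀ m : Fin r, Finset (Fin (n m))) (p : Fin r → ℕ)
    (hcard : ∀ m, (P m).card = p m) (hp0 : ∀ m, 0 < p m) (hpn : ∀ m, 2 * p m ≤ n m)
    {N : ℕ} (κ : Fin N → Fin (r + 1)) (h2 : Module.finrank ℚ (Kf i₀) = 2) (im : ∀ m : Fin r, Kf i₀ →+* Kf (is m))
    {δ : 𝓞 (Kf i₀)} {d : ℕ} (hτ : τ (δ : Kf i₀) = Complex.I * (Real.sqrt d : ℂ))
    (hA : ∀ j, IsCMTypeRealisation (Φ j) (A j) (ι j) (θ j))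
    (e : ∀ m : Fin r, (Kf (is m) →+* ℂ) ≃ Fin (n m) × Bool)
    (he_sign : ∀ (m : Fin r) (s : Kf (is m) →+* ℂ), (e m s).2 = true ↔ s.comp (im m) = τ)
    (he_conj : ∀ (m : Fin r) (s : Kf (is m) →+* ℂ), e m (ComplexEmbedding.conjugate s) = ((e m s).1, !(e m s).2))
    (hΨ : ∀ σ : Kf i₀ →+* ℂ, σ ∈ (Φ 0).1 ↔ σ = τ)
    (hΦ : ∀ (m : Fin r) (s : Kf (is m) →+* ℂ), s ∈ (Φ m.succ).1 ↔ (e m s).2 = decide ((e m s).1 ∈ P m))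
    (hkind : ∀ m : Fin r, (n m).Prime ∨ p m = 1 ∨ ∀ Q : Finset (Fin (n m)), Q.card = p m → ∃ π ∈ realisedTuples e τ, preG (π m) (P m) = Q)
    (hstab : ∀ (m₀ m : Fin r), m₀ ≠ m → ∀ a a' : Fin (n m), ∃ ν ∈ realisedTuples e τ, ν m₀ = 1 ∧ ν m a = a')
    (hW : ∀ m : Fin r, weilClassesOf (⨁ fun i => A (partSlots (n m - 2 * p m) m i))
      (biproduct.map fun i => ι (partSlots (n m - 2 * p m) m i) (δfam im δ (partSlots (n m - 2 * p m) m i))) (n m - p m) d ≤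
      algebraicClasses (⨁ fun i => A (partSlots (n m - 2 * p m) m i)).X (n m - p m)) :
    HodgeConjectureFor (⨁ fun j => A (κ j)).dim (⨁ fun j => A (κ j)).X :=
  hodgeConjectureFor_biproduct_comp_of_defectLawG (is := is) P (fun m => n m - 2 * p m) (fun m => n m - p m)
    (fun m => by have := hpn m; omega) (fun m => by have := hp0 m; have := hpn m; omega) κ h2 im hτ hA e he_sign he_conj hΨ hΦ
    (fun v T hT => exists_hasDefectsG_realisedTuples_of_stabiliserTransitive_kind (e := e) he_sign hstab
      (fun m => by
        rcases hkind m with hpr | h1 | hhom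
        · exact Or.inl ⟨hpr, Finset.card_pos.1 (by rw [hcard m]; exact hp0 m), by have := hpn m; have := hp0 m; rw [hcard m]; omega⟩
        · exact Or.inr (Or.inl (by rw [hcard m, h1]))
        · exact Or.inr (Or.inr ⟨⟨by rw [hcard m]; exact hp0 m, by have := hpn m; have := hp0 m; rw [hcard m]; omega⟩,
            fun Q hQ => hhom Q (by rw [hQ, hcard m])⟩))
      (fun m => n m - 2 * p m) (cast_sub_two_mul_eq hcard hpn) v T hT) hW

end Frames

/-! ## §2 The intrinsic headline under `hST` for the menu `(3,1), (4,1), (4,2), (5,2)` -/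

section Intrinsic

variable {I : Type} {r : ℕ} {Kf : I → Type} [∀ i, Field (Kf i)] [∀ i, NumberField (Kf i)] [∀ i, IsCMField (Kf i)]
  {i₀ : I} {is : Fin r → I} {τ : Kf i₀ →+* ℂ}
  {A : Fin (r + 1) → AbelianVariety ℂ} {Φ : ∀ j : Fin (r + 1), CMType (Kf (mfSlots i₀ is j))}
  {ι : ∀ j, 𝓞 (Kf (mfSlots i₀ is j)) →+* End (A j)}
  {θ : ∀ j, Kf (mfSlots i₀ is j) →+* Module.End ℂ (complexBetti (A j).X 1)}

/-- **HEADLINE — SEXTIC `(1,2)`, OCTIC `(1,3)` ∕ `(2,2)` AND DECIC `(2,3)` CM FIELDS SHARING `k`, STABILISER-TRANSITIVE AUTOMORPHISMS, `2`-TRANSITIVE QUARTIC PART ON THE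
`(2,2)` SLOTS — GIVEN ONLY MARKMAN'S TWO THEOREMS.**  `k = Kf i₀` imaginary quadratic, `E = A 0 ⊨ (k; {τ})`, `B_m = A (m+1) ⊨ (K_m; Φ (m+1))`, `[K_m : ℚ] = 2 n_m` with
`(n_m, p_m) ∈ {(3,1), (4,1), (4,2), (5,2)}` (`p_m` members of `Φ (m+1)` over `τ`); `hST`: for `m₀ ≠ m` and `τ`-embeddings `s, s'` of `K_m` an automorphism of `ℂ` over `τ(k)`
fixes all `τ`-embeddings of `K_{m₀}` and carries `s` to `s'`; `h2T`: for each slot with `(n_m, p_m) = (4,2)` the automorphisms of `ℂ` over `τ(k)` are `2`-transitive on the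
`τ`-embeddings of `K_m`.  Then the Hodge conjecture holds for EVERY product of copies `⨁_j A(κ j)`.  `HC_CM` is NOT asserted. [cite: Markman2025SurveySecant, Thm. 1.2]
[cite: Markman2025SecantWeil, Thm 1.5.1] [cite: Pohlmann1968, Thm 1] [cite: MoonenZarhin1995Duke, Thm. 2.4] [cite: DixonMortimer1996, §1.6, Thm. 1.6A; §2.1] -/
theorem hodgeConjectureFor_biproduct_comp_of_octics_of_stabiliserTransitive (hW4 : Markman2025_weilClasses_algebraic_abelianFourfold)
    (hM6 : Markman2025_weilClasses_algebraic_hyperbolicSixfold) (n p : Fin r → ℕ)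
    (hnp : ∀ m, (n m = 3 ∧ p m = 1) ∨ (n m = 4 ∧ p m = 1) ∨ (n m = 4 ∧ p m = 2) ∨ (n m = 5 ∧ p m = 2))
    {N : ℕ} (κ : Fin N → Fin (r + 1)) (h2 : Module.finrank ℚ (Kf i₀) = 2) (hdeg : ∀ m : Fin r, Module.finrank ℚ (Kf (is m)) = 2 * n m)
    (im : ∀ m : Fin r, Kf i₀ →+* Kf (is m)) (hA : ∀ j, IsCMTypeRealisation (Φ j) (A j) (ι j) (θ j)) (hΨ : ∀ σ : Kf i₀ →+* ℂ, σ ∈ (Φ 0).1 ↔ σ = τ)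
    (hp : ∀ m : Fin r, (Finset.univ.filter fun s : Kf (is m) →+* ℂ => s.comp (im m) = τ ∧ s ∈ (Φ m.succ).1).card = p m)
    (hST : ∀ (m₀ m : Fin r), m₀ ≠ m → ∀ s s' : Kf (is m) →+* ℂ, s.comp (im m) = τ → s'.comp (im m) = τ →
      ∃ ρ : ℂ ≃+* ℂ, (ρ : ℂ →+* ℂ).comp τ = τ ∧ (∀ u : Kf (is m₀) →+* ℂ, u.comp (im m₀) = τ → (ρ : ℂ →+* ℂ).comp u = u) ∧ (ρ : ℂ →+* ℂ).comp s = s')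
    (h2T : ∀ m : Fin r, n m = 4 → p m = 2 → ∀ s₁ s₂ s₁' s₂' : Kf (is m) →+* ℂ, s₁.comp (im m) = τ → s₂.comp (im m) = τ → s₁'.comp (im m) = τ →
      s₂'.comp (im m) = τ → s₁ ≠ s₂ → s₁' ≠ s₂' → ∃ ρ : ℂ ≃+* ℂ, (ρ : ℂ →+* ℂ).comp τ = τ ∧ (ρ : ℂ →+* ℂ).comp s₁ = s₁' ∧ (ρ : ℂ →+* ℂ).comp s₂ = s₂') :
    HodgeConjectureFor (⨁ fun j => A (κ j)).dim (⨁ fun j => A (κ j)).X := by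
  obtain ⟨δ₀, d, hd, hδ₀⟩ := CyclicSextic.exists_sq_eq_neg_nat_of_isTotallyComplex (Kf i₀) h2
  obtain ⟨δ, hδ, hτ⟩ := OcticCurveFourfold.exists_delta_of_mem h2 hd hδ₀ τ
  have hττ : ComplexEmbedding.conjugate τ ≠ τ := QuarticCM.conjugate_ne τ
  have hk : ∀ σ : Kf i₀ →+* ℂ, σ = τ ∨ σ = ComplexEmbedding.conjugate τ := fun σ => QuarticCM.eq_or_eq_conjugate_of_quadratic h2 τ σ
  have hfr : ∀ m : Fin r, ∃ e : (Kf (is m) →+* ℂ) ≃ Fin (n m) × Bool, (∀ s, (e s).2 = true ↔ s.comp (im m) = τ) ∧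
      ∀ s, e (ComplexEmbedding.conjugate s) = ((e s).1, !(e s).2) := fun m => exists_signFrame (hdeg m) h2 (im m) hττ hk
  choose e he_sign he_conj using hfr
  have hcard : ∀ m, (Finset.univ.filter fun a : Fin (n m) => (e m).symm (a, true) ∈ (Φ m.succ).1).card = p m := fun m =>
    (card_posSet (he_sign m) (Φ m.succ)).trans (hp m)
  refine hodgeConjectureFor_biproduct_comp_of_kind_frames (is := is) (n := n)
    (fun m => Finset.univ.filter fun a : Fin (n m) => (e m).symm (a, true) ∈ (Φ m.succ).1) p hcard (fun m => ?_) (fun m => ?_) κ h2 im hτ hA e he_sign he_conj hΨ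
    (fun m s => mem_iff_snd_eq_decide_mem_posSet (he_conj m) (Φ m.succ) s) (fun m => ?_) (stabTransitive_realisedTuples_of_aut he_sign hST) fun m => ?_
  · rcases hnp m with ⟨-, h⟩ | ⟨-, h⟩ | ⟨-, h⟩ | ⟨-, h⟩ <;> rw [h] <;> norm_num
  · rcases hnp m with ⟨h, h'⟩ | ⟨h, h'⟩ | ⟨h, h'⟩ | ⟨h, h'⟩ <;> rw [h, h'] <;> norm_num
  · rcases hnp m with ⟨h, -⟩ | ⟨-, h'⟩ | ⟨h, h'⟩ | ⟨h, -⟩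
    · exact Or.inl (by rw [h]; exact Nat.prime_three)
    · exact Or.inr (Or.inl h')
    · have hhom := homogeneous_two_of_twoTransitive (R := realisedTuples e τ)
        (P := fun m => Finset.univ.filter fun a : Fin (n m) => (e m).symm (a, true) ∈ (Φ m.succ).1) (m := m) (by rw [hcard m, h'])
        (twoTransitive_realisedTuples_of_aut (e := e) he_sign m (h2T m h h'))
      exact Or.inr (Or.inr fun Q hQ => hhom Q (by rw [hQ, hcard m]))
    · exact Or.inl (by rw [h]; exact Nat.prime_five)
  · exact weilHyp_of_markman_intrinsic hW4 hM6 m (hnp m) (hdeg m) h2 hd hδ hA hΨ (hp m)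

end Intrinsic

/-! ## §3 `hST` discharged: the mixed menu of sizes `3`, `4`, `5` -/

section Menu

variable {I : Type} {r : ℕ} {Kf : I → Type} [∀ i, Field (Kf i)] [∀ i, NumberField (Kf i)] {i₀ : I} {is : Fin r → I} {n : Fin r → ℕ}
  {e : ∀ m : Fin r, (Kf (is m) →+* ℂ) ≃ Fin (n m) × Bool} {τ : Kf i₀ →+* ℂ} {im : ∀ m : Fin r, Kf i₀ →+* Kf (is m)}
  (he_sign : ∀ (m : Fin r) (s : Kf (is m) →+* ℂ), (e m s).2 = true ↔ s.comp (im m) = τ)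

include he_sign in
/-- **STABILISER-TRANSITIVITY FOR THE MIXED MENU OF SIZES `3`, `4`, `5`.**  Frames `e`; `n_m ∈ {3, 4, 5}`; the realised tuples `2`-transitive on every slot of size `4`; and
for the pairs `m₀ ≠ m` with `n_{m₀} = n_m` or `(n_{m₀}, n_m) = (4, 3)` some `τ`-embedding of `K_m` takes some value outside `L(K_{m₀})`.  Then for ALL `m₀ ≠ m` the realised
tuples trivial at `m₀` are transitive on the slot `m` — W1 (`3→3`, `5→5`, `4→3`), Y2 (`3↔5`), Z2 (`3→4`, `5→4`, `4→5`, `4→4`). [cite: DixonMortimer1996, §1.6, Thm. 1.6A; §3.3, Thm. 3.3A]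
[cite: Wielandt1964, §9–§10] [cite: Shimura1998, §18.2 Lemma (i)] [cite: Lang2002, VI §1 Thm. 1.1 and Cor. 1.6] -/
theorem stabTransitive_realisedTuples_of_menu (hn : ∀ m, n m = 3 ∨ n m = 4 ∨ n m = 5)
    (h2t : ∀ m, n m = 4 → ∀ a b a' b' : Fin (n m), a ≠ b → a' ≠ b' → ∃ π ∈ realisedTuples e τ, π m a = a' ∧ π m b = b')
    (hout : ∀ (m₀ m : Fin r), m₀ ≠ m → (n m₀ = n m ∨ (n m₀ = 4 ∧ n m = 3)) →
      ∃ s : Kf (is m) →+* ℂ, s.comp (im m) = τ ∧ ∃ x, s x ∉ normalClosure ℚ (Kf (is m₀)) ℂ)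
    (m₀ m : Fin r) (hm : m₀ ≠ m) (a a' : Fin (n m)) : ∃ ν ∈ realisedTuples e τ, ν m₀ = 1 ∧ ν m a = a' := by
  rcases hn m with h3 | h4 | h5
  · -- into a slot of size `3`: from `3` or `4` by W1 (a value outside), from `5` by Y2
    rcases hn m₀ with h3₀ | h4₀ | h5₀
    · exact stabTransitive_realisedTuples_of_outside_prime (e := e) he_sign m₀ m (by rw [h3]; exact Nat.prime_three) (hout m₀ m hm (Or.inl (h3₀.trans h3.symm))) a a'
    · exact stabTransitive_realisedTuples_of_outside_prime (e := e) he_sign m₀ m (by rw [h3]; exact Nat.prime_three) (hout m₀ m hm (Or.inr ⟨h4₀, h3⟩)) a a'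
    · exact stabTransitive_realisedTuples_of_sizes_three_five (e := e) he_sign m₀ m (Or.inl ⟨h5₀, h3⟩) a a'
  · -- into a slot of size `4`: from `3` or `5` for free, from `4` by a value outside; primitivity
    rcases hn m₀ with h3₀ | h4₀ | h5₀
    · exact stabTransitive_realisedTuples_into_four (e := e) he_sign m₀ m (Or.inl h3₀) h4 (h2t m h4) a a'
    · exact stabTransitive_realisedTuples_of_outside_twoTransitive (e := e) he_sign m₀ m (h2t m h4) (hout m₀ m hm (Or.inl (h4₀.trans h4.symm))) a a'
    · exact stabTransitive_realisedTuples_into_four (e := e) he_sign m₀ m (Or.inr h5₀) h4 (h2t m h4) a a'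
  · -- into a slot of size `5`: from `3` by Y2, from `4` for free, from `5` by W1
    rcases hn m₀ with h3₀ | h4₀ | h5₀
    · exact stabTransitive_realisedTuples_of_sizes_three_five (e := e) he_sign m₀ m (Or.inr ⟨h3₀, h5⟩) a a'
    · exact stabTransitive_realisedTuples_into_five_of_four (e := e) he_sign m₀ m h4₀ h5 a a'
    · exact stabTransitive_realisedTuples_of_outside_prime (e := e) he_sign m₀ m (by rw [h5]; exact Nat.prime_five) (hout m₀ m hm (Or.inl (h5₀.trans h5.symm))) a a'

end Menu

/-! ## §4 The headline: sextics, octics with `2`-transitive quartic part, decics -/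

section Headline

variable {I : Type} {r : ℕ} {Kf : I → Type} [∀ i, Field (Kf i)] [∀ i, NumberField (Kf i)] [∀ i, IsCMField (Kf i)]
  {i₀ : I} {is : Fin r → I} {τ : Kf i₀ →+* ℂ}
  {A : Fin (r + 1) → AbelianVariety ℂ} {Φ : ∀ j : Fin (r + 1), CMType (Kf (mfSlots i₀ is j))}
  {ι : ∀ j, 𝓞 (Kf (mfSlots i₀ is j)) →+* End (A j)}
  {θ : ∀ j, Kf (mfSlots i₀ is j) →+* Module.End ℂ (complexBetti (A j).X 1)}

/-- **HEADLINE — ANY NUMBER OF SIMPLE CM THREEFOLDS (SEXTIC FIELDS), OF `(1,3)`- AND `(2,2)`-FOURFOLDS OVER OCTIC FIELDS WITH `2`-TRANSITIVE QUARTIC PART, AND OF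
`(2,3)`-FIVEFOLDS (DECIC FIELDS), ALL THROUGH `k`, GIVEN ONLY MARKMAN'S FOURFOLD AND HYPERBOLIC-SIXFOLD THEOREMS.**  `k = Kf i₀` imaginary quadratic, `E = A 0 ⊨ (k; {τ})`,
`B_m = A (m+1) ⊨ (K_m; Φ (m+1))`, `[K_m : ℚ] = 2 n_m`, `(n_m, p_m) ∈ {(3,1), (4,1), (4,2), (5,2)}` (`p_m` members of `Φ (m+1)` over `τ`).  HYPOTHESES: (i) for every OCTIC
`K_m` (`n_m = 4`) the automorphisms of `ℂ` over `τ(k)` permute its four `τ`-embeddings `2`-TRANSITIVELY (quartic part `𝔄₄` or `𝔖₄`); (ii) for `m₀ ≠ m` with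
`n_{m₀} = n_m`, and for `n_{m₀} = 4`, `n_m = 3`, some `τ`-embedding of `K_m` takes some value outside the Galois closure of `K_{m₀}` in `ℂ` (NOTHING is asked for the other
pairs of degrees).  Then the Hodge conjecture holds for EVERY product of copies `E^a × ∏_m B_m^{b_m}`.  `HC_CM` is NOT asserted.  NOT covered: octic fields with quartic
part `C₄`, `V₄`, `D₄`; non-isogenous factors over isomorphic fields. [cite: Markman2025SurveySecant, Thm. 1.2] [cite: Markman2025SecantWeil, Thm 1.5.1] [cite: Pohlmann1968, Thm 1]
[cite: MoonenZarhin1995Duke, Thm. 2.4] [cite: DixonMortimer1996, §1.6, Thm. 1.6A; §3.3, Thm. 3.3A] [cite: Wielandt1964, §9–§10] [cite: Lang2002, I §5 Thm. 5.5, VI §1 Cor. 1.6] -/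
theorem hodgeConjectureFor_biproduct_comp_of_sexticsOcticsDecics (hW4 : Markman2025_weilClasses_algebraic_abelianFourfold)
    (hM6 : Markman2025_weilClasses_algebraic_hyperbolicSixfold) (n p : Fin r → ℕ)
    (hnp : ∀ m, (n m = 3 ∧ p m = 1) ∨ (n m = 4 ∧ p m = 1) ∨ (n m = 4 ∧ p m = 2) ∨ (n m = 5 ∧ p m = 2))
    {N : ℕ} (κ : Fin N → Fin (r + 1)) (h2 : Module.finrank ℚ (Kf i₀) = 2) (hdeg : ∀ m : Fin r, Module.finrank ℚ (Kf (is m)) = 2 * n m)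
    (im : ∀ m : Fin r, Kf i₀ →+* Kf (is m)) (hA : ∀ j, IsCMTypeRealisation (Φ j) (A j) (ι j) (θ j)) (hΨ : ∀ σ : Kf i₀ →+* ℂ, σ ∈ (Φ 0).1 ↔ σ = τ)
    (hp : ∀ m : Fin r, (Finset.univ.filter fun s : Kf (is m) →+* ℂ => s.comp (im m) = τ ∧ s ∈ (Φ m.succ).1).card = p m)
    (h2T : ∀ m : Fin r, n m = 4 → ∀ s₁ s₂ s₁' s₂' : Kf (is m) →+* ℂ, s₁.comp (im m) = τ → s₂.comp (im m) = τ → s₁'.comp (im m) = τ →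
      s₂'.comp (im m) = τ → s₁ ≠ s₂ → s₁' ≠ s₂' → ∃ ρ : ℂ ≃+* ℂ, (ρ : ℂ →+* ℂ).comp τ = τ ∧ (ρ : ℂ →+* ℂ).comp s₁ = s₁' ∧ (ρ : ℂ →+* ℂ).comp s₂ = s₂')
    (hout : ∀ (m₀ m : Fin r), m₀ ≠ m → (n m₀ = n m ∨ (n m₀ = 4 ∧ n m = 3)) →
      ∃ s : Kf (is m) →+* ℂ, s.comp (im m) = τ ∧ ∃ x, s x ∉ normalClosure ℚ (Kf (is m₀)) ℂ) :
    HodgeConjectureFor (⨁ fun j => A (κ j)).dim (⨁ fun j => A (κ j)).X := by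
  obtain ⟨δ₀, d, hd, hδ₀⟩ := CyclicSextic.exists_sq_eq_neg_nat_of_isTotallyComplex (Kf i₀) h2
  obtain ⟨δ, hδ, hτ⟩ := OcticCurveFourfold.exists_delta_of_mem h2 hd hδ₀ τ
  have hττ : ComplexEmbedding.conjugate τ ≠ τ := QuarticCM.conjugate_ne τ
  have hk : ∀ σ : Kf i₀ →+* ℂ, σ = τ ∨ σ = ComplexEmbedding.conjugate τ := fun σ => QuarticCM.eq_or_eq_conjugate_of_quadratic h2 τ σ
  have hfr : ∀ m : Fin r, ∃ e : (Kf (is m) →+* ℂ) ≃ Fin (n m) × Bool, (∀ s, (e s).2 = true ↔ s.comp (im m) = τ) ∧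
      ∀ s, e (ComplexEmbedding.conjugate s) = ((e s).1, !(e s).2) := fun m => exists_signFrame (hdeg m) h2 (im m) hττ hk
  choose e he_sign he_conj using hfr
  have hcard : ∀ m, (Finset.univ.filter fun a : Fin (n m) => (e m).symm (a, true) ∈ (Φ m.succ).1).card = p m := fun m =>
    (card_posSet (he_sign m) (Φ m.succ)).trans (hp m)
  have hn : ∀ m, n m = 3 ∨ n m = 4 ∨ n m = 5 := fun m => by
    rcases hnp m with ⟨h, -⟩ | ⟨h, -⟩ | ⟨h, -⟩ | ⟨h, -⟩
    exacts [Or.inl h, Or.inr (Or.inl h), Or.inr (Or.inl h), Or.inr (Or.inr h)]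
  have h2t : ∀ m, n m = 4 → ∀ a b a' b' : Fin (n m), a ≠ b → a' ≠ b' → ∃ π ∈ realisedTuples e τ, π m a = a' ∧ π m b = b' := fun m h4 =>
    twoTransitive_realisedTuples_of_aut (e := e) he_sign m (h2T m h4)
  refine hodgeConjectureFor_biproduct_comp_of_kind_frames (is := is) (n := n)
    (fun m => Finset.univ.filter fun a : Fin (n m) => (e m).symm (a, true) ∈ (Φ m.succ).1) p hcard (fun m => ?_) (fun m => ?_) κ h2 im hτ hA e he_sign he_conj hΨ
    (fun m s => mem_iff_snd_eq_decide_mem_posSet (he_conj m) (Φ m.succ) s) (fun m => ?_) (stabTransitive_realisedTuples_of_menu he_sign hn h2t hout) fun m => ?_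
  · rcases hnp m with ⟨-, h⟩ | ⟨-, h⟩ | ⟨-, h⟩ | ⟨-, h⟩ <;> rw [h] <;> norm_num
  · rcases hnp m with ⟨h, h'⟩ | ⟨h, h'⟩ | ⟨h, h'⟩ | ⟨h, h'⟩ <;> rw [h, h'] <;> norm_num
  · rcases hnp m with ⟨h, -⟩ | ⟨-, h'⟩ | ⟨h, h'⟩ | ⟨h, -⟩
    · exact Or.inl (by rw [h]; exact Nat.prime_three)
    · exact Or.inr (Or.inl h')
    · have hhom := homogeneous_two_of_twoTransitive (R := realisedTuples e τ)
        (P := fun m => Finset.univ.filter fun a : Fin (n m) => (e m).symm (a, true) ∈ (Φ m.succ).1) (m := m) (by rw [hcard m, h']) (h2t m h)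
      exact Or.inr (Or.inr fun Q hQ => hhom Q (by rw [hQ, hcard m]))
    · exact Or.inl (by rw [h]; exact Nat.prime_five)
  · exact weilHyp_of_markman_intrinsic hW4 hM6 m (hnp m) (hdeg m) h2 hd hδ hA hΨ (hp m)

/-- **Dominated form**: every complex abelian variety dominated by such a product of copies satisfies the Hodge conjecture, given Markman's two theorems.
[cite: Markman2025SurveySecant, Thm. 1.2] [cite: Markman2025SecantWeil, Thm 1.5.1] [cite: MumfordAV1970, §19] -/
theorem hodgeConjectureFor_of_avDominatedBy_comp_of_sexticsOcticsDecics (hW4 : Markman2025_weilClasses_algebraic_abelianFourfold)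
    (hM6 : Markman2025_weilClasses_algebraic_hyperbolicSixfold) (n p : Fin r → ℕ)
    (hnp : ∀ m, (n m = 3 ∧ p m = 1) ∨ (n m = 4 ∧ p m = 1) ∨ (n m = 4 ∧ p m = 2) ∨ (n m = 5 ∧ p m = 2))
    {N : ℕ} (κ : Fin N → Fin (r + 1)) (h2 : Module.finrank ℚ (Kf i₀) = 2) (hdeg : ∀ m : Fin r, Module.finrank ℚ (Kf (is m)) = 2 * n m)
    (im : ∀ m : Fin r, Kf i₀ →+* Kf (is m)) (hA : ∀ j, IsCMTypeRealisation (Φ j) (A j) (ι j) (θ j)) (hΨ : ∀ σ : Kf i₀ →+* ℂ, σ ∈ (Φ 0).1 ↔ σ = τ)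
    (hp : ∀ m : Fin r, (Finset.univ.filter fun s : Kf (is m) →+* ℂ => s.comp (im m) = τ ∧ s ∈ (Φ m.succ).1).card = p m)
    (h2T : ∀ m : Fin r, n m = 4 → ∀ s₁ s₂ s₁' s₂' : Kf (is m) →+* ℂ, s₁.comp (im m) = τ → s₂.comp (im m) = τ → s₁'.comp (im m) = τ →
      s₂'.comp (im m) = τ → s₁ ≠ s₂ → s₁' ≠ s₂' → ∃ ρ : ℂ ≃+* ℂ, (ρ : ℂ →+* ℂ).comp τ = τ ∧ (ρ : ℂ →+* ℂ).comp s₁ = s₁' ∧ (ρ : ℂ →+* ℂ).comp s₂ = s₂')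
    (hout : ∀ (m₀ m : Fin r), m₀ ≠ m → (n m₀ = n m ∨ (n m₀ = 4 ∧ n m = 3)) →
      ∃ s : Kf (is m) →+* ℂ, s.comp (im m) = τ ∧ ∃ x, s x ∉ normalClosure ℚ (Kf (is m₀)) ℂ)
    {X : AbelianVariety ℂ} (hX : Domination.AVDominatedBy X (⨁ fun j => A (κ j))) : HodgeConjectureFor X.dim X.X :=
  Domination.hodgeConjectureFor_of_avDominatedBy
    (hodgeConjectureFor_biproduct_comp_of_sexticsOcticsDecics hW4 hM6 n p hnp κ h2 hdeg im hA hΨ hp h2T hout) hX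

/-- **`Hom = ∅` FORM FOR THE SEXTIC AND DECIC PAIRS**: hypothesis (ii) for `m₀ ≠ m` both sextic or both decic is implied by `Hom(K_m, K_{m₀}) = ∅` (W1 §3, Y1 §1); the
octic–octic and octic→sextic pairs keep the «value outside the closure» form.  `HC_CM` is NOT asserted. [cite: Markman2025SurveySecant, Thm. 1.2] [cite: Markman2025SecantWeil, Thm 1.5.1]
[cite: Dodson1984, §1.1 Imprimitivity Theorem and §5.1.2 Theorem] [cite: DixonMortimer1996, §3.3, Thm. 3.3A] [cite: Lang2002, VI §1 Thm. 1.1] -/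
theorem hodgeConjectureFor_biproduct_comp_of_sexticsOcticsDecics_of_isEmpty_ringHom (hW4 : Markman2025_weilClasses_algebraic_abelianFourfold)
    (hM6 : Markman2025_weilClasses_algebraic_hyperbolicSixfold) (n p : Fin r → ℕ)
    (hnp : ∀ m, (n m = 3 ∧ p m = 1) ∨ (n m = 4 ∧ p m = 1) ∨ (n m = 4 ∧ p m = 2) ∨ (n m = 5 ∧ p m = 2))
    {N : ℕ} (κ : Fin N → Fin (r + 1)) (h2 : Module.finrank ℚ (Kf i₀) = 2) (hdeg : ∀ m : Fin r, Module.finrank ℚ (Kf (is m)) = 2 * n m)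
    (im : ∀ m : Fin r, Kf i₀ →+* Kf (is m)) (hA : ∀ j, IsCMTypeRealisation (Φ j) (A j) (ι j) (θ j)) (hΨ : ∀ σ : Kf i₀ →+* ℂ, σ ∈ (Φ 0).1 ↔ σ = τ)
    (hp : ∀ m : Fin r, (Finset.univ.filter fun s : Kf (is m) →+* ℂ => s.comp (im m) = τ ∧ s ∈ (Φ m.succ).1).card = p m)
    (h2T : ∀ m : Fin r, n m = 4 → ∀ s₁ s₂ s₁' s₂' : Kf (is m) →+* ℂ, s₁.comp (im m) = τ → s₂.comp (im m) = τ → s₁'.comp (im m) = τ →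
      s₂'.comp (im m) = τ → s₁ ≠ s₂ → s₁' ≠ s₂' → ∃ ρ : ℂ ≃+* ℂ, (ρ : ℂ →+* ℂ).comp τ = τ ∧ (ρ : ℂ →+* ℂ).comp s₁ = s₁' ∧ (ρ : ℂ →+* ℂ).comp s₂ = s₂')
    (hiso : ∀ (m₀ m : Fin r), m₀ ≠ m → n m₀ = n m → (n m = 3 ∨ n m = 5) → IsEmpty (Kf (is m) →+* Kf (is m₀)))
    (hout4 : ∀ (m₀ m : Fin r), m₀ ≠ m → n m₀ = 4 → (n m = 4 ∨ n m = 3) →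
      ∃ s : Kf (is m) →+* ℂ, s.comp (im m) = τ ∧ ∃ x, s x ∉ normalClosure ℚ (Kf (is m₀)) ℂ) :
    HodgeConjectureFor (⨁ fun j => A (κ j)).dim (⨁ fun j => A (κ j)).X := by
  refine hodgeConjectureFor_biproduct_comp_of_sexticsOcticsDecics hW4 hM6 n p hnp κ h2 hdeg im hA hΨ hp h2T fun m₀ m hm hnm => ?_
  -- a `τ`-embedding of `K_m`
  have hc := SexticOcticWeil.card_filter_comp_eq_of_finrank (n := n m) (im m) (hdeg m) h2 τ
  obtain ⟨s, hs⟩ := Finset.card_pos.1 (by rw [hc]; rcases hnp m with ⟨h, -⟩ | ⟨h, -⟩ | ⟨h, -⟩ | ⟨h, -⟩ <;> rw [h] <;> norm_num)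
  have hs' : s.comp (im m) = τ := (Finset.mem_filter.1 hs).2
  rcases hnm with heq | ⟨h4₀, h3⟩
  · rcases hnp m with ⟨h3, -⟩ | ⟨h4, -⟩ | ⟨h4, -⟩ | ⟨h5, -⟩
    · exact ⟨s, hs', exists_apply_not_mem_normalClosure_of_isEmpty_ringHom h2 im (by rw [hdeg m₀, heq, h3]) (by rw [hdeg m, h3])
        (hiso m₀ m hm heq (Or.inl h3)) s hs'⟩
    · exact hout4 m₀ m hm (heq.trans h4) (Or.inl h4)
    · exact hout4 m₀ m hm (heq.trans h4) (Or.inl h4)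
    · exact ⟨s, hs', exists_apply_not_mem_normalClosure_of_isEmpty_ringHom_five h2 im (by rw [hdeg m₀, heq, h5]) (by rw [hdeg m, h5])
        (hiso m₀ m hm heq (Or.inr h5)) s hs'⟩
  · exact hout4 m₀ m hm h4₀ (Or.inr h3)

/-- **Dominated form of the `Hom = ∅` form.** [cite: Markman2025SurveySecant, Thm. 1.2] [cite: Markman2025SecantWeil, Thm 1.5.1] [cite: MumfordAV1970, §19] -/
theorem hodgeConjectureFor_of_avDominatedBy_comp_of_sexticsOcticsDecics_of_isEmpty_ringHom (hW4 : Markman2025_weilClasses_algebraic_abelianFourfold)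
    (hM6 : Markman2025_weilClasses_algebraic_hyperbolicSixfold) (n p : Fin r → ℕ)
    (hnp : ∀ m, (n m = 3 ∧ p m = 1) ∨ (n m = 4 ∧ p m = 1) ∨ (n m = 4 ∧ p m = 2) ∨ (n m = 5 ∧ p m = 2))
    {N : ℕ} (κ : Fin N → Fin (r + 1)) (h2 : Module.finrank ℚ (Kf i₀) = 2) (hdeg : ∀ m : Fin r, Module.finrank ℚ (Kf (is m)) = 2 * n m)
    (im : ∀ m : Fin r, Kf i₀ →+* Kf (is m)) (hA : ∀ j, IsCMTypeRealisation (Φ j) (A j) (ι j) (θ j)) (hΨ : ∀ σ : Kf i₀ →+* ℂ, σ ∈ (Φ 0).1 ↔ σ = τ)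
    (hp : ∀ m : Fin r, (Finset.univ.filter fun s : Kf (is m) →+* ℂ => s.comp (im m) = τ ∧ s ∈ (Φ m.succ).1).card = p m)
    (h2T : ∀ m : Fin r, n m = 4 → ∀ s₁ s₂ s₁' s₂' : Kf (is m) →+* ℂ, s₁.comp (im m) = τ → s₂.comp (im m) = τ → s₁'.comp (im m) = τ →
      s₂'.comp (im m) = τ → s₁ ≠ s₂ → s₁' ≠ s₂' → ∃ ρ : ℂ ≃+* ℂ, (ρ : ℂ →+* ℂ).comp τ = τ ∧ (ρ : ℂ →+* ℂ).comp s₁ = s₁' ∧ (ρ : ℂ →+* ℂ).comp s₂ = s₂')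
    (hiso : ∀ (m₀ m : Fin r), m₀ ≠ m → n m₀ = n m → (n m = 3 ∨ n m = 5) → IsEmpty (Kf (is m) →+* Kf (is m₀)))
    (hout4 : ∀ (m₀ m : Fin r), m₀ ≠ m → n m₀ = 4 → (n m = 4 ∨ n m = 3) →
      ∃ s : Kf (is m) →+* ℂ, s.comp (im m) = τ ∧ ∃ x, s x ∉ normalClosure ℚ (Kf (is m₀)) ℂ)
    {X : AbelianVariety ℂ} (hX : Domination.AVDominatedBy X (⨁ fun j => A (κ j))) : HodgeConjectureFor X.dim X.X :=
  Domination.hodgeConjectureFor_of_avDominatedBy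
    (hodgeConjectureFor_biproduct_comp_of_sexticsOcticsDecics_of_isEmpty_ringHom hW4 hM6 n p hnp κ h2 hdeg im hA hΨ hp h2T hiso hout4) hX

end Headline

end Summit.HodgeConjecture.CorCM.MultiFieldWeil

end
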